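import Literature.NumberTheory.LFunctions.ColossallyAbundantQuotient
import HarnessLib

/-!
# Colossally abundant numbers: the divisibility chain and the Alaoglu–Erdős question

Topic: `Literature/NumberTheory/LFunctions`. Sibling proof file of `ColossallyAbundant.lean`
(provefact `Nat.caSeq_dvd_succ`), building on `ColossallyAbundantQuotient.lean`. Writing
`F_ε(m) = σ(m)/m^{1+ε}` (the term of `Nat.IsCAParameter`, kept inline).

## What is proved, and the status of `Nat.caSeq_dvd_succ`

The named fact `Nat.caSeq_dvd_succ` (`∀ k, caSeq k ∣ caSeq (k+1)`, for the tree's convention that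
*every* maximiser `≥ 2` of some `F_ε`, `ε > 0`, is colossally abundant) is not the theorem
Alaoglu–Erdős prove: granted the six exponentials theorem it is *equivalent* to "no positive
parameter is critical for two distinct primes" (`Nat.caSeq_dvd_succ_iff`,
`ColossallyAbundantQuotient.lean`), which is the question Alaoglu–Erdős leave open (p. 449: "If
`p` and `q` are different primes, is it true that `p^x` and `q^x` are both rational only if `x` is
an integer?"; p. 455: "At present we can not show this"; Lagarias 2002, §2: "still unsolved").
This file adds:

* `Nat.IsCAParameter.dvd_of_le_of_forall_lt`, `Nat.IsCAParameter.dvd_of_le_of_forall_lt_left` —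
  **the divisibility chain in Alaoglu–Erdős's own convention, unconditionally**: a *largest*
  (p. 448: "`>` for `m > n`") or *smallest* (Lagarias 2002, §2, footnote: "`>` for `1 ≤ k < n`")
  maximiser of `F_ε` divides every maximiser of any `F_{ε'}` that is at least as large. This is
  the content of p. 455, "the numbers `n_ε` and `k_q(ε)` do not decrease as `ε` decreases", i.e.
  what `Nat.caSeq_dvd_succ` transcribes, read in the convention in which it is a theorem.
* `Nat.IsCAParameter.gcd`, `Nat.IsCAParameter.lcm` — the maximisers of one `F_ε` are closed
  under `gcd` and `lcm` (`F(lcm) F(gcd) = F(n) F(n')` by multiplicativity of `σ`); with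
  `Nat.IsCAParameter.le_of_lt` (parameters are anti-monotone in the number) and
  `Nat.IsCAParameter.dvd_of_lt` (`ColossallyAbundantQuotient.lean`) this gives the dichotomy
  `Nat.ColossallyAbundant.dvd_or_common_parameter`: two colossally abundant numbers `n < n'`
  (consecutive or not) either divide each other or have one and the same parameter `ε`, at
  which `gcd n n' < n < n' < lcm n n'` are four maximisers (Erdős–Nicolas 1975, Prop. 4 (d);
  Lagarias 2002, §2: "two or four different integers").
* `Nat.not_two_ties_of_alaogluErdos` — a positive answer to the Alaoglu–Erdős question (spelled
  out as the hypothesis `hAE`; it is an open problem and only ever a hypothesis here) forbids two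
  primes tying at one parameter (at a tie `p^{1+ε} = σ(p^{a+1})/σ(p^a) ∈ ℚ`, and `ε ∉ ℚ` by
  `Nat.irrational_of_sigma_div_eq_rpow`); hence, through the `…_of_not_two_ties` results of
  `ColossallyAbundantQuotient.lean`, `Nat.caSeq_succ_eq_prime_mul_of_alaogluErdos`,
  `Nat.AlaogluErdos1944_quotient_of_alaogluErdos`, `Nat.caSeq_dvd_succ_of_alaogluErdos`,
  `Nat.caSeq_div_prime_of_alaogluErdos` (p. 455: the answer "would show that the quotient of two
  consecutive colossally abundant numbers is a prime").
* `Nat.alaogluErdos_of_fourExponentials` — the four exponentials conjecture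
  (`Literature.NumberTheory.Transcendental.FourExponentialsConjecture`, `PeriodsWave0.lean`) answers the question
  positively (Lagarias 2002, §2, footnote 2: `a₁ = log p`, `a₂ = log q`, `b₁ = 1`, `b₂ = x` for
  irrational `x`; "for non-integer rational `x` a direct argument is used" — here `p`-adic
  valuation, `Nat.exists_intCast_eq_of_prime_rpow_ratCast`), with
  `Nat.linearIndependent_log_of_prime_ne` and `Irrational.linearIndependent_one` as the two
  independence inputs. (`ColossallyAbundantQuotient.lean` derives "no two ties" from the four
  exponentials conjecture directly; the route through the Alaoglu–Erdős question isolates the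
  weaker Diophantine hypothesis that suffices.)
* `Nat.ColossallyAbundant.dvd_of_le` — from `Nat.caSeq_dvd_succ` all colossally abundant numbers
  are pairwise comparable under divisibility.
* `Nat.ColossallyAbundantAE.dvd_of_le_of_colossallyAbundant`, `Nat.ColossallyAbundantAE.dvd_of_le`,
  `Nat.caSeq_dvd_succ_of_colossallyAbundantAE` — **the corrected reading of the named fact
  `Nat.caSeq_dvd_succ`**, phrased with the tree's predicate `Nat.ColossallyAbundantAE`
  (Alaoglu–Erdős's own definition, p. 448), unconditionally: a colossally abundant number in
  their sense divides every colossally abundant number (either convention) that is at least as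
  large; in particular the chain `caSeq k ∣ caSeq (k+1)` can only break at a term `caSeq k` that
  is *not* colossally abundant in Alaoglu–Erdős's sense (a middle maximiser `qN < rN` at a
  parameter shared by two primes — the configuration whose non-existence is their open question).

## Sources

* L. Alaoglu, P. Erdős, *On highly composite and similar numbers*, Trans. AMS 56 (1944),
  448–469: p. 448 (definition), p. 449 (the Diophantine question), §3, p. 455 (monotonicity of
  `n_ε`, "this makes `q^x` rational", the conjecture, Siegel's communication).
  [AlaogluErdos1944] (held: doi 10.1090/s0002-9947-1944-0011087-2, PDF pp. 2, 8.)
* J. C. Lagarias, *An elementary problem equivalent to the Riemann hypothesis*, Amer. Math.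
  Monthly 109 (2002), §2 ("Conjecture (Alaoglu and Erdős) … still unsolved"; footnotes 1–2;
  "two or four different integers"). [Lagarias2002] (held: arXiv math/0008177, pp. 3–4.)
* P. Erdős, J.-L. Nicolas, *Répartition des nombres superabondants*, Bull. SMF 103 (1975),
  Prop. 4, p. 70–71. [ErdosNicolas1975]

## Design choices

* Pure proof file: no definitions. The Alaoglu–Erdős question is written out as the hypothesis
  `hAE : ∀ p q x, p.Prime → q.Prime → p ≠ q → p^x ∈ ℚ → q^x ∈ ℚ → x ∈ ℤ` (over real `x`), exactly
  as `ColossallyAbundantQuotient.lean` writes out "no two ties"; the named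
  `def Nat.AlaogluErdosConjecture : Prop` (same wording) is proposed separately as the reviewed
  definition file `AlaogluErdosConjecture.lean`, which re-exports the results below under it.
* Alaoglu–Erdős's convention is written out as in `ColossallyAbundantQuotient.lean`
  (`IsCAParameter ε n ∧ ∀ m > n, F_ε(m) < F_ε(n)`), so nothing here depends on the pending
  `Nat.ColossallyAbundantAE`.
-/

noncomputable section

open Real Finset
open scoped ArithmeticFunction.sigma

namespace Nat

/-! ### `F_s(m) = σ(m)/m^s`: exponent shift and the `gcd`/`lcm` identity -/

/-- `F_s(n) ≥ 0`. [folklore] -/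
theorem sigma_div_rpow_nonneg (s : ℝ) (n : ℕ) : (0 : ℝ) ≤ (σ 1 n : ℝ) / (n : ℝ) ^ s := by
  positivity

/-- Exponent shift: `F_{1+ε}(m) = F_{1+ε+δ}(m) · m^δ` for `m ≥ 1`. [folklore] -/
theorem sigma_div_rpow_shift (ε δ : ℝ) {m : ℕ} (hm : 1 ≤ m) :
    (σ 1 m : ℝ) / (m : ℝ) ^ (1 + ε) =
      (σ 1 m : ℝ) / (m : ℝ) ^ (1 + (ε + δ)) * (m : ℝ) ^ δ := by
  have hm0 : (0 : ℝ) < m := by exact_mod_cast hm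
  rw [show 1 + (ε + δ) = (1 + ε) + δ by ring, rpow_add hm0 (1 + ε) δ]
  have h1 : (m : ℝ) ^ (1 + ε) ≠ 0 := (rpow_pos_of_pos hm0 _).ne'
  have h2 : (m : ℝ) ^ δ ≠ 0 := (rpow_pos_of_pos hm0 _).ne'
  field_simp

/-- **Multiplicativity over `gcd`/`lcm`:** `F_s(lcm n n') · F_s(gcd n n') = F_s(n) · F_s(n')`, from
`σ(lcm) σ(gcd) = σ(n) σ(n')` (Mathlib `IsMultiplicative.lcm_apply_mul_gcd_apply`) and
`lcm · gcd = n · n'`. [folklore] -/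
theorem sigma_div_rpow_lcm_mul_gcd (s : ℝ) (n n' : ℕ) :
    (σ 1 (n.lcm n') : ℝ) / (n.lcm n' : ℝ) ^ s * ((σ 1 (n.gcd n') : ℝ) / (n.gcd n' : ℝ) ^ s) =
      (σ 1 n : ℝ) / (n : ℝ) ^ s * ((σ 1 n' : ℝ) / (n' : ℝ) ^ s) := by
  have hσ : (σ 1 (n.lcm n') : ℝ) * (σ 1 (n.gcd n') : ℝ) = (σ 1 n : ℝ) * (σ 1 n' : ℝ) := by
    exact_mod_cast
      ArithmeticFunction.isMultiplicative_sigma.lcm_apply_mul_gcd_apply (x := n) (y := n')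
  have hlg : ((n.lcm n' : ℕ) : ℝ) * ((n.gcd n' : ℕ) : ℝ) = (n : ℝ) * (n' : ℝ) := by
    rw [mul_comm]
    exact_mod_cast Nat.gcd_mul_lcm n n'
  have hpow : ((n.lcm n' : ℕ) : ℝ) ^ s * ((n.gcd n' : ℕ) : ℝ) ^ s = (n : ℝ) ^ s * (n' : ℝ) ^ s := by
    rw [← mul_rpow (Nat.cast_nonneg _) (Nat.cast_nonneg _),
      ← mul_rpow (Nat.cast_nonneg _) (Nat.cast_nonneg _), hlg]
  rw [_root_.div_mul_div_comm, _root_.div_mul_div_comm, hσ, hpow]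

/-! ### Maximisers of one `F_ε`: closure under `gcd`/`lcm`; parameters are anti-monotone -/

/-- A number with a parameter is `≥ 1` (`F_ε(0) = 0 < 1 = F_ε(1)`). [folklore] -/
theorem IsCAParameter.one_le {ε : ℝ} {n : ℕ} (h : IsCAParameter ε n) : 1 ≤ n := by
  by_contra h0
  obtain rfl : n = 0 := by omega
  have := h 1 le_rfl
  norm_num at this

/-- The maximal value `F_ε(n)` is positive. [folklore] -/
theorem IsCAParameter.value_pos {ε : ℝ} {n : ℕ} (h : IsCAParameter ε n) :
    (0 : ℝ) < (σ 1 n : ℝ) / (n : ℝ) ^ (1 + ε) :=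
  sigma_div_rpow_pos ε (by have := h.one_le; omega)

/-- Any `k` whose value is at least the maximum is itself a maximiser. [folklore] -/
theorem IsCAParameter.of_le {ε : ℝ} {n k : ℕ} (h : IsCAParameter ε n)
    (hle : (σ 1 n : ℝ) / (n : ℝ) ^ (1 + ε) ≤ (σ 1 k : ℝ) / (k : ℝ) ^ (1 + ε)) :
    IsCAParameter ε k :=
  fun m hm => (h m hm).trans hle

/-- Two maximisers for the same `ε` have the same value. [folklore] -/
theorem IsCAParameter.value_eq {ε : ℝ} {n n' : ℕ} (hn : IsCAParameter ε n)
    (hn' : IsCAParameter ε n') :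
    (σ 1 n' : ℝ) / (n' : ℝ) ^ (1 + ε) = (σ 1 n : ℝ) / (n : ℝ) ^ (1 + ε) :=
  le_antisymm (hn n' hn'.one_le) (hn' n hn.one_le)

/-- **Closure of the maximisers under `gcd` and `lcm`** (the mechanism behind "two or four
different integers" attaining the maximum, Lagarias 2002, §2, after Erdős–Nicolas 1975,
Prop. 4 (d)): if `n` and `n'` both maximise `F_ε`, so do `gcd n n'` and `lcm n n'`. Proof:
`F(lcm) F(gcd) = F(n) F(n') = M²` with `F(lcm), F(gcd) ≤ M` and `M > 0`.
[cite: Lagarias2002, §2 ("two or four different integers")] -/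
theorem IsCAParameter.gcd_and_lcm {ε : ℝ} {n n' : ℕ} (hn : IsCAParameter ε n)
    (hn' : IsCAParameter ε n') :
    IsCAParameter ε (n.gcd n') ∧ IsCAParameter ε (n.lcm n') := by
  have h1 := hn.one_le
  have h1' := hn'.one_le
  have hD1 : 1 ≤ n.gcd n' := Nat.gcd_pos_of_pos_left _ h1
  have hL1 : 1 ≤ n.lcm n' := Nat.lcm_pos h1 h1'
  set M : ℝ := (σ 1 n : ℝ) / (n : ℝ) ^ (1 + ε) with hM_def
  set FD : ℝ := (σ 1 (n.gcd n') : ℝ) / (n.gcd n' : ℝ) ^ (1 + ε) with hFD_def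
  set FL : ℝ := (σ 1 (n.lcm n') : ℝ) / (n.lcm n' : ℝ) ^ (1 + ε) with hFL_def
  have hMn' : (σ 1 n' : ℝ) / (n' : ℝ) ^ (1 + ε) = M := hn.value_eq hn'
  have hD : FD ≤ M := hn _ hD1
  have hL : FL ≤ M := hn _ hL1
  have hprod : FL * FD = M * M := by
    rw [hFL_def, hFD_def, sigma_div_rpow_lcm_mul_gcd, hMn']
  have hM : 0 < M := hn.value_pos
  have hD0 : 0 ≤ FD := sigma_div_rpow_nonneg _ _
  have hL0 : 0 ≤ FL := sigma_div_rpow_nonneg _ _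
  have hDeq : FD = M := by
    by_contra hne
    have hlt : FD < M := lt_of_le_of_ne hD hne
    have : FL * FD < M * M :=
      calc FL * FD ≤ M * FD := mul_le_mul_of_nonneg_right hL hD0
        _ < M * M := mul_lt_mul_of_pos_left hlt hM
    linarith
  have hLeq : FL = M := by
    by_contra hne
    have hlt : FL < M := lt_of_le_of_ne hL hne
    have : FL * FD < M * M :=
      calc FL * FD ≤ FL * M := mul_le_mul_of_nonneg_left hD hL0
        _ < M * M := mul_lt_mul_of_pos_right hlt hM
    linarith
  exact ⟨hn.of_le hDeq.ge, hn.of_le hLeq.ge⟩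

/-- `gcd` of two maximisers of `F_ε` is a maximiser. [cite: Lagarias2002, §2] -/
theorem IsCAParameter.gcd {ε : ℝ} {n n' : ℕ} (hn : IsCAParameter ε n)
    (hn' : IsCAParameter ε n') : IsCAParameter ε (n.gcd n') :=
  (hn.gcd_and_lcm hn').1

/-- `lcm` of two maximisers of `F_ε` is a maximiser. [cite: Lagarias2002, §2] -/
theorem IsCAParameter.lcm {ε : ℝ} {n n' : ℕ} (hn : IsCAParameter ε n)
    (hn' : IsCAParameter ε n') : IsCAParameter ε (n.lcm n') :=
  (hn.gcd_and_lcm hn').2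

/-- **Parameters are anti-monotone:** if `ε` is a parameter of `n`, `ε'` a parameter of `n'`, and
`n < n'`, then `ε' ≤ ε` (larger colossally abundant numbers belong to smaller `ε`; Alaoglu–Erdős
1944, p. 455: "the numbers `n_ε` … do not decrease as `ε` decreases"). Proof: `F_ε(n') ≤ F_ε(n)`
and `F_{ε'}(n) ≤ F_{ε'}(n')` give `(n'/n)^{ε'} ≤ (n'/n)^{ε}`. [cite: AlaogluErdos1944, §3, p. 455] -/
theorem IsCAParameter.le_of_lt {ε ε' : ℝ} {n n' : ℕ} (hn : IsCAParameter ε n)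
    (hn' : IsCAParameter ε' n') (hlt : n < n') : ε' ≤ ε := by
  by_contra hlt'
  obtain ⟨δ, hδ, rfl⟩ : ∃ δ : ℝ, 0 < δ ∧ ε' = ε + δ := ⟨ε' - ε, by linarith, by ring⟩
  have h1 := hn.one_le
  have h1' := hn'.one_le
  have hA : (σ 1 n' : ℝ) / (n' : ℝ) ^ (1 + ε) ≤ (σ 1 n : ℝ) / (n : ℝ) ^ (1 + ε) := hn n' h1'
  rw [sigma_div_rpow_shift ε δ h1', sigma_div_rpow_shift ε δ h1] at hA
  have hB : (σ 1 n : ℝ) / (n : ℝ) ^ (1 + (ε + δ)) ≤ (σ 1 n' : ℝ) / (n' : ℝ) ^ (1 + (ε + δ)) :=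
    hn' n h1
  have hpos : (0 : ℝ) < (σ 1 n' : ℝ) / (n' : ℝ) ^ (1 + (ε + δ)) := hn'.value_pos
  have hnδ : (0 : ℝ) ≤ (n : ℝ) ^ δ := rpow_nonneg (Nat.cast_nonneg n) δ
  have hC : (σ 1 n' : ℝ) / (n' : ℝ) ^ (1 + (ε + δ)) * (n' : ℝ) ^ δ ≤
      (σ 1 n' : ℝ) / (n' : ℝ) ^ (1 + (ε + δ)) * (n : ℝ) ^ δ :=
    hA.trans (mul_le_mul_of_nonneg_right hB hnδ)
  have hD : (n' : ℝ) ^ δ ≤ (n : ℝ) ^ δ := le_of_mul_le_mul_left hC hpos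
  have hE : (n : ℝ) ^ δ < (n' : ℝ) ^ δ :=
    rpow_lt_rpow (Nat.cast_nonneg n) (by exact_mod_cast hlt) hδ
  linarith

/-- Hence, if `n < n'` have parameters `ε`, `ε'` and `n ∤ n'`, then `ε' = ε`: the two numbers have
one and the same parameter (`ε' < ε` would give `n ∣ n'`, `Nat.IsCAParameter.dvd_of_lt`).
[cite: AlaogluErdos1944, §3, p. 455] -/
theorem IsCAParameter.eq_of_not_dvd {ε ε' : ℝ} {n n' : ℕ} (hn : IsCAParameter ε n)
    (hn' : IsCAParameter ε' n') (hlt : n < n') (hnd : ¬ n ∣ n') : ε' = ε := by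
  rcases (hn.le_of_lt hn' hlt).lt_or_eq with h | h
  · exact absurd (hn.dvd_of_lt hn' h (by have := hn.one_le; omega)
      (by have := hn'.one_le; omega)) hnd
  · exact h

/-- **Dichotomy for colossally abundant numbers** (tree convention: all maximisers). For
colossally abundant `n < n'` (consecutive or not): either `n ∣ n'`, or there is `ε > 0` which is
THE unique parameter of `n` and of `n'`, and `gcd n n'`, `lcm n n'` are maximisers of `F_ε` as
well — four maximisers `gcd < n < n' < lcm` of one parameter (Erdős–Nicolas 1975, Prop. 4 (d);
Lagarias 2002, §2: "two or four different integers"), the configuration a positive answer to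
the Alaoglu–Erdős question excludes. [cite: Lagarias2002, §2] -/
theorem ColossallyAbundant.dvd_or_common_parameter {n n' : ℕ} (hn : ColossallyAbundant n)
    (hn' : ColossallyAbundant n') (hlt : n < n') :
    n ∣ n' ∨ ∃ ε : ℝ, 0 < ε ∧ (∀ μ : ℝ, IsCAParameter μ n ↔ μ = ε) ∧
      (∀ μ : ℝ, IsCAParameter μ n' ↔ μ = ε) ∧
      IsCAParameter ε (n.gcd n') ∧ IsCAParameter ε (n.lcm n') ∧
      n.gcd n' < n ∧ n' < n.lcm n' := by
  by_cases hd : n ∣ n'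
  · exact Or.inl hd
  right
  obtain ⟨-, ε, hε, hεn⟩ := (colossallyAbundant_iff n).1 hn
  obtain ⟨-, ε', -, hε'n'⟩ := (colossallyAbundant_iff n').1 hn'
  have hεε' : ε' = ε := hεn.eq_of_not_dvd hε'n' hlt hd
  subst hεε'
  have h1 := hεn.one_le
  have h1' := hε'n'.one_le
  refine ⟨ε', hε, fun μ => ⟨fun hμ => (hμ.eq_of_not_dvd hε'n' hlt hd).symm, ?_⟩,
    fun μ => ⟨fun hμ => hεn.eq_of_not_dvd hμ hlt hd, ?_⟩, hεn.gcd hε'n', hεn.lcm hε'n', ?_, ?_⟩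
  · rintro rfl
    exact hεn
  · rintro rfl
    exact hε'n'
  · -- `gcd < n`: `gcd ∣ n`, and `gcd = n` would give `n ∣ n'`
    have hle : n.gcd n' ≤ n := Nat.le_of_dvd (by omega) (Nat.gcd_dvd_left n n')
    rcases hle.lt_or_eq with h | h
    · exact h
    · exact absurd (h ▸ Nat.gcd_dvd_right n n') hd
  · have hle : n' ≤ n.lcm n' := Nat.le_of_dvd (Nat.lcm_pos h1 h1') (Nat.dvd_lcm_right n n')
    rcases hle.lt_or_eq with h | h
    · exact h
    · exact absurd (h.symm ▸ Nat.dvd_lcm_left n n') hd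

/-- Along the enumeration: `caSeq k ∣ caSeq (k + 1)`, unless `caSeq k` and `caSeq (k+1)` have one
and the same parameter `ε`, at which `gcd` and `lcm` are maximisers too (four maximisers of
parameter `ε`). Unconditional. [cite: Lagarias2002, §2] -/
theorem caSeq_dvd_succ_or_common_parameter (k : ℕ) :
    caSeq k ∣ caSeq (k + 1) ∨ ∃ ε : ℝ, 0 < ε ∧
      (∀ μ : ℝ, IsCAParameter μ (caSeq k) ↔ μ = ε) ∧
      (∀ μ : ℝ, IsCAParameter μ (caSeq (k + 1)) ↔ μ = ε) ∧
      IsCAParameter ε ((caSeq k).gcd (caSeq (k + 1))) ∧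
      IsCAParameter ε ((caSeq k).lcm (caSeq (k + 1))) ∧
      (caSeq k).gcd (caSeq (k + 1)) < caSeq k ∧ caSeq (k + 1) < (caSeq k).lcm (caSeq (k + 1)) :=
  (colossallyAbundant_caSeq' k).dvd_or_common_parameter (colossallyAbundant_caSeq' (k + 1))
    (caSeq_strictMono' (Nat.lt_succ_self k))

/-! ### The divisibility chain in Alaoglu–Erdős's convention (unconditional) -/

/-- **The largest maximiser divides every larger maximiser** — the divisibility chain of
Alaoglu–Erdős's colossally abundant numbers (p. 448: `n` is colossally abundant for `ε` if
`F_ε(m) ≤ F_ε(n)` for `m < n` and `F_ε(m) < F_ε(n)` for `m > n`, i.e. `n` is the largest maximiser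
of `F_ε`; p. 455: "the numbers `n_ε` and `k_q(ε)` do not decrease as `ε` decreases"): if `n` is
the largest maximiser of `F_ε` and `n' ≥ n` maximises some `F_{ε'}`, then `n ∣ n'`. This is the
statement that the named fact `Nat.caSeq_dvd_succ` (`ColossallyAbundant.lean`) transcribes, in
the convention in which Alaoglu–Erdős assert it; for the tree's all-maximisers convention see
`Nat.caSeq_dvd_succ_iff` (`ColossallyAbundantQuotient.lean`) and
`Nat.caSeq_dvd_succ_of_alaogluErdos` below. Proof: `ε' < ε` gives `n ∣ n'`
(`Nat.IsCAParameter.dvd_of_lt`); `ε' = ε` gives `n' ≤ n`; `ε < ε'` gives `n' ∣ n`.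
[cite: AlaogluErdos1944, §3, p. 455] -/
theorem IsCAParameter.dvd_of_le_of_forall_lt {ε ε' : ℝ} {n n' : ℕ} (hP : IsCAParameter ε n)
    (hPmax : ∀ m : ℕ, n < m → (σ 1 m : ℝ) / (m : ℝ) ^ (1 + ε) < (σ 1 n : ℝ) / (n : ℝ) ^ (1 + ε))
    (hP' : IsCAParameter ε' n') (hle : n ≤ n') : n ∣ n' := by
  have hn0 : n ≠ 0 := by have := hP.one_le; omega
  have hn0' : n' ≠ 0 := by have := hP'.one_le; omega
  rcases lt_trichotomy ε' ε with hlt | rfl | hgt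
  · exact hP.dvd_of_lt hP' hlt hn0 hn0'
  · have hge : n' ≤ n := hP'.le_of_forall_lt hPmax hn0
    obtain rfl : n = n' := le_antisymm hle hge
    exact dvd_rfl
  · have hge : n' ≤ n := Nat.le_of_dvd (by omega) (hP'.dvd_of_lt hP hgt hn0' hn0)
    obtain rfl : n = n' := le_antisymm hle hge
    exact dvd_rfl

/-- **The same for the smallest-maximiser reading** (Lagarias 2002, §2, footnote 1 paraphrases
Alaoglu–Erdős's definition with the strict inequality for `1 ≤ k < n`; Alaoglu–Erdős's §3
construction, p. 455, also takes the smaller exponent at a critical `ε`): if `n' ` is the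
smallest maximiser of `F_{ε'}` and `n ≤ n'` maximises some `F_ε`, then `n ∣ n'`.
[cite: AlaogluErdos1944, §3, p. 455] -/
theorem IsCAParameter.dvd_of_le_of_forall_lt_left {ε ε' : ℝ} {n n' : ℕ}
    (hP : IsCAParameter ε n) (hP' : IsCAParameter ε' n')
    (hP'min : ∀ m : ℕ, 1 ≤ m → m < n' →
      (σ 1 m : ℝ) / (m : ℝ) ^ (1 + ε') < (σ 1 n' : ℝ) / (n' : ℝ) ^ (1 + ε'))
    (hle : n ≤ n') : n ∣ n' := by
  have h1 := hP.one_le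
  have hn0 : n ≠ 0 := by omega
  have hn0' : n' ≠ 0 := by have := hP'.one_le; omega
  rcases lt_trichotomy ε' ε with hlt | rfl | hgt
  · exact hP.dvd_of_lt hP' hlt hn0 hn0'
  · rcases hle.lt_or_eq with hlt | rfl
    · exact absurd (hP'min n h1 hlt) (not_lt.2 (hP n' hP'.one_le))
    · exact dvd_rfl
  · have hge : n' ≤ n := Nat.le_of_dvd (by omega) (hP'.dvd_of_lt hP hgt hn0' hn0)
    obtain rfl : n = n' := le_antisymm hle hge
    exact dvd_rfl

/-- In particular two largest maximisers (Alaoglu–Erdős's colossally abundant numbers, p. 448)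
`n ≤ n'` satisfy `n ∣ n'`: their colossally abundant numbers form a chain under divisibility.
[cite: AlaogluErdos1944, §3, p. 455] -/
theorem IsCAParameter.dvd_of_le_of_largest {ε ε' : ℝ} {n n' : ℕ} (hP : IsCAParameter ε n)
    (hPmax : ∀ m : ℕ, n < m → (σ 1 m : ℝ) / (m : ℝ) ^ (1 + ε) < (σ 1 n : ℝ) / (n : ℝ) ^ (1 + ε))
    (hP' : IsCAParameter ε' n')
    (_hP'max : ∀ m : ℕ, n' < m →
      (σ 1 m : ℝ) / (m : ℝ) ^ (1 + ε') < (σ 1 n' : ℝ) / (n' : ℝ) ^ (1 + ε'))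
    (hle : n ≤ n') : n ∣ n' :=
  hP.dvd_of_le_of_forall_lt hPmax hP' hle

/-! ### The Alaoglu–Erdős question forbids two ties -/

/-- **A positive answer to the Alaoglu–Erdős question forbids two primes tying at one parameter**
(Alaoglu–Erdős 1944, p. 455: a critical `ε` for `q` "makes `q^x` rational. It is very likely that
`q^x` and `p^x` can not be rational at the same time except if `x` is an integer"; p. 449 states
the question). At a tie `σ(p^{a+1})/σ(p^a) = p^{1+ε}` the power `p^{1+ε}` is rational, so two
ties at `p ≠ q` would make `1 + ε` an integer, whereas `ε` is irrational
(`Nat.irrational_of_sigma_div_eq_rpow`). The hypothesis `hAE` is the question's positive answer,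
an open problem, used only as a hypothesis. [cite: AlaogluErdos1944, §3, p. 455] -/
theorem not_two_ties_of_alaogluErdos
    (hAE : ∀ (p q : ℕ) (x : ℝ), p.Prime → q.Prime → p ≠ q →
      (∃ a : ℚ, (p : ℝ) ^ x = a) → (∃ b : ℚ, (q : ℝ) ^ x = b) → ∃ k : ℤ, x = k)
    {ε : ℝ} (hε : 0 < ε) {p q a b : ℕ} (hp : p.Prime) (hq : q.Prime) (hpq : p ≠ q)
    (ha : (σ 1 (p ^ (a + 1)) : ℝ) / σ 1 (p ^ a) = (p : ℝ) ^ (1 + ε))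
    (hb : (σ 1 (q ^ (b + 1)) : ℝ) / σ 1 (q ^ b) = (q : ℝ) ^ (1 + ε)) : False := by
  have hpa : ∃ a' : ℚ, (p : ℝ) ^ (1 + ε) = a' := by
    refine ⟨(σ 1 (p ^ (a + 1)) : ℚ) / (σ 1 (p ^ a) : ℚ), ?_⟩
    rw [← ha]
    push_cast
    rfl
  have hqb : ∃ b' : ℚ, (q : ℝ) ^ (1 + ε) = b' := by
    refine ⟨(σ 1 (q ^ (b + 1)) : ℚ) / (σ 1 (q ^ b) : ℚ), ?_⟩
    rw [← hb]
    push_cast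
    rfl
  obtain ⟨k, hk⟩ := hAE p q (1 + ε) hp hq hpq hpa hqb
  exact irrational_of_sigma_div_eq_rpow hp hε ha ⟨(k : ℚ) - 1, by push_cast; linarith⟩

/-- Under a positive answer to the Alaoglu–Erdős question the quotient of consecutive colossally
abundant numbers (tree convention) is a single prime (Alaoglu–Erdős 1944, p. 455: "This would
show that the quotient of two consecutive colossally abundant numbers is a prime").
[cite: AlaogluErdos1944, §3, p. 455] -/
theorem ColossallyAbundant.consecutive_quotient_of_alaogluErdos
    (hAE : ∀ (p q : ℕ) (x : ℝ), p.Prime → q.Prime → p ≠ q →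
      (∃ a : ℚ, (p : ℝ) ^ x = a) → (∃ b : ℚ, (q : ℝ) ^ x = b) → ∃ k : ℤ, x = k)
    {n n' : ℕ} (hn : ColossallyAbundant n) (hn' : ColossallyAbundant n') (hlt : n < n')
    (hnone : ∀ m : ℕ, n < m → m < n' → ¬ ColossallyAbundant m) :
    ∃ p : ℕ, p.Prime ∧ n' = p * n :=
  hn.consecutive_quotient_of_not_two_ties
    (fun hε _ _ _ _ hp hq hpq ha hb => not_two_ties_of_alaogluErdos hAE hε hp hq hpq ha hb)
    hn' hlt hnone

/-- Along `caSeq`: `caSeq (k+1) = p · caSeq k` for a prime `p`, under a positive answer to the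
Alaoglu–Erdős question. [cite: AlaogluErdos1944, §3, p. 455] -/
theorem caSeq_succ_eq_prime_mul_of_alaogluErdos
    (hAE : ∀ (p q : ℕ) (x : ℝ), p.Prime → q.Prime → p ≠ q →
      (∃ a : ℚ, (p : ℝ) ^ x = a) → (∃ b : ℚ, (q : ℝ) ^ x = b) → ∃ k : ℤ, x = k)
    (k : ℕ) : ∃ p : ℕ, p.Prime ∧ caSeq (k + 1) = p * caSeq k :=
  caSeq_succ_eq_prime_mul_of_not_two_ties
    (fun hε _ _ _ _ hp hq hpq ha hb => not_two_ties_of_alaogluErdos hAE hε hp hq hpq ha hb) k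

/-- The named fact `Nat.AlaogluErdos1944_quotient` (`ColossallyAbundant.lean`, tree convention)
under a positive answer to the Alaoglu–Erdős question, in its first alternative.
[cite: AlaogluErdos1944, §3, p. 455] -/
theorem AlaogluErdos1944_quotient_of_alaogluErdos
    (hAE : ∀ (p q : ℕ) (x : ℝ), p.Prime → q.Prime → p ≠ q →
      (∃ a : ℚ, (p : ℝ) ^ x = a) → (∃ b : ℚ, (q : ℝ) ^ x = b) → ∃ k : ℤ, x = k) :
    AlaogluErdos1944_quotient := fun k =>
  let ⟨p, hp, hk⟩ := caSeq_succ_eq_prime_mul_of_alaogluErdos hAE k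
  ⟨p, hp, Or.inl hk⟩

/-- **`Nat.caSeq_dvd_succ` under a positive answer to the Alaoglu–Erdős question** — the honest
status of the named fact for the tree's convention: a consequence of an open Diophantine
question (p. 449), itself answered by the four exponentials conjecture
(`Nat.caSeq_dvd_succ_of_fourExponentials`), and, granted the six exponentials theorem,
equivalent to "no two ties" (`Nat.caSeq_dvd_succ_iff`). [cite: AlaogluErdos1944, §3, p. 455] -/
theorem caSeq_dvd_succ_of_alaogluErdos
    (hAE : ∀ (p q : ℕ) (x : ℝ), p.Prime → q.Prime → p ≠ q →
      (∃ a : ℚ, (p : ℝ) ^ x = a) → (∃ b : ℚ, (q : ℝ) ^ x = b) → ∃ k : ℤ, x = k) :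
    caSeq_dvd_succ :=
  caSeq_dvd_succ_of_quotient (AlaogluErdos1944_quotient_of_alaogluErdos hAE)

/-- The shape of route item `RobinAlaogluErdosFourExp` (Summits/RiemannHypothesis,
Theses/Robin), from the weaker hypothesis: under a positive answer to the Alaoglu–Erdős question,
`(caSeq (k+1) / caSeq k).Prime ∧ caSeq k ∣ caSeq (k+1)` for every `k`.
[cite: AlaogluErdos1944, §3, p. 455] -/
theorem caSeq_div_prime_of_alaogluErdos
    (hAE : ∀ (p q : ℕ) (x : ℝ), p.Prime → q.Prime → p ≠ q →
      (∃ a : ℚ, (p : ℝ) ^ x = a) → (∃ b : ℚ, (q : ℝ) ^ x = b) → ∃ k : ℤ, x = k)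
    (k : ℕ) : (caSeq (k + 1) / caSeq k).Prime ∧ caSeq k ∣ caSeq (k + 1) := by
  obtain ⟨p, hp, hk⟩ := caSeq_succ_eq_prime_mul_of_alaogluErdos hAE k
  have h0 : 0 < caSeq k := by have := (colossallyAbundant_caSeq' k).1; omega
  refine ⟨?_, ⟨p, by rw [hk, mul_comm]⟩⟩
  rwa [hk, Nat.mul_div_cancel _ h0]

/-- From the chain property all colossally abundant numbers are pairwise comparable under
divisibility (every colossally abundant number is a term of `caSeq`). [folklore] -/
theorem ColossallyAbundant.dvd_of_le (h : caSeq_dvd_succ) {n n' : ℕ} (hn : ColossallyAbundant n)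
    (hn' : ColossallyAbundant n') (hle : n ≤ n') : n ∣ n' := by
  obtain ⟨k, rfl⟩ := exists_caSeq_eq hn
  obtain ⟨k', rfl⟩ := exists_caSeq_eq hn'
  exact caSeq_dvd_of_le h (caSeq_strictMono'.le_iff_le.1 hle)

/-! ### The four exponentials conjecture answers the Alaoglu–Erdős question (Lagarias 2002, §2) -/

/-- `m log p + n log q = 0` with integers `m, n` and distinct primes `p, q` forces `m = n = 0`
(exponentiate: `p^m q^n = 1` in `ℚ`; take `p`- and `q`-adic valuations). [folklore] -/
theorem int_mul_log_add_int_mul_log_eq_zero {p q : ℕ} (hp : p.Prime) (hq : q.Prime) (hpq : p ≠ q)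
    {m n : ℤ} (h : (m : ℝ) * Real.log p + n * Real.log q = 0) : m = 0 ∧ n = 0 := by
  haveI := Fact.mk hp
  haveI := Fact.mk hq
  have hp0 : (0 : ℝ) < p := by exact_mod_cast hp.pos
  have hq0 : (0 : ℝ) < q := by exact_mod_cast hq.pos
  have hR : (p : ℝ) ^ m * (q : ℝ) ^ n = 1 := by
    have h1 : Real.exp ((m : ℝ) * Real.log p + n * Real.log q) = 1 := by rw [h, Real.exp_zero]
    rw [Real.exp_add, show (m : ℝ) * Real.log p = Real.log p * m by ring,
      show (n : ℝ) * Real.log q = Real.log q * n by ring, ← rpow_def_of_pos hp0,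
      ← rpow_def_of_pos hq0, rpow_intCast, rpow_intCast] at h1
    exact h1
  have hQ : (p : ℚ) ^ m * (q : ℚ) ^ n = 1 := by
    have : (((p : ℚ) ^ m * (q : ℚ) ^ n : ℚ) : ℝ) = (1 : ℚ) := by push_cast; exact hR
    exact_mod_cast this
  have hpQ : (p : ℚ) ≠ 0 := by exact_mod_cast hp.ne_zero
  have hqQ : (q : ℚ) ≠ 0 := by exact_mod_cast hq.ne_zero
  have hvp := congrArg (padicValRat p) hQ
  have hvq := congrArg (padicValRat q) hQ
  rw [padicValRat.mul (zpow_ne_zero _ hpQ) (zpow_ne_zero _ hqQ), padicValRat.zpow,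
    padicValRat.zpow, padicValRat.one] at hvp hvq
  have hpp : padicValRat p (p : ℚ) = 1 := padicValRat.self hp.one_lt
  have hqq : padicValRat q (q : ℚ) = 1 := padicValRat.self hq.one_lt
  have hpq' : padicValRat p (q : ℚ) = 0 := by
    rw [← padicValRat_of_nat, padicValNat_primes hpq]; simp
  have hqp' : padicValRat q (p : ℚ) = 0 := by
    rw [← padicValRat_of_nat, padicValNat_primes (Ne.symm hpq)]; simp
  rw [hpp, hpq'] at hvp
  rw [hqp', hqq] at hvq
  constructor
  · simpa using hvp
  · simpa using hvq

/-- `log p` and `log q` are `ℚ`-linearly independent (in `ℂ`) for distinct primes `p ≠ q` — the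
first hypothesis of the four exponentials conjecture in Lagarias's footnote (`a₁ = log p`,
`a₂ = log q`). [cite: Lagarias2002, §2 (footnote 2)] -/
theorem linearIndependent_log_of_prime_ne {p q : ℕ} (hp : p.Prime) (hq : q.Prime) (hpq : p ≠ q) :
    LinearIndependent ℚ ![((Real.log p : ℝ) : ℂ), ((Real.log q : ℝ) : ℂ)] := by
  rw [LinearIndependent.pair_iff]
  intro s t hst
  have hC : (((s : ℝ) * Real.log p + (t : ℝ) * Real.log q : ℝ) : ℂ) = 0 := by
    rw [Rat.smul_def, Rat.smul_def] at hst
    push_cast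
    rw [← hst]
    push_cast
    ring
  have hR : (s : ℝ) * Real.log p + (t : ℝ) * Real.log q = 0 := by exact_mod_cast hC
  -- clear denominators
  set m : ℤ := s.num * t.den with hm
  set n : ℤ := t.num * s.den with hn
  have hs : (s : ℝ) * (s.den : ℝ) = (s.num : ℝ) := by exact_mod_cast Rat.mul_den_eq_num s
  have ht : (t : ℝ) * (t.den : ℝ) = (t.num : ℝ) := by exact_mod_cast Rat.mul_den_eq_num t
  have hZ : (m : ℝ) * Real.log p + n * Real.log q = 0 := by
    have : (m : ℝ) * Real.log p + n * Real.log q =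
        ((s.den : ℝ) * t.den) * ((s : ℝ) * Real.log p + (t : ℝ) * Real.log q) := by
      rw [hm, hn]
      push_cast
      rw [← hs, ← ht]
      ring
    rw [this, hR, mul_zero]
  obtain ⟨hm0, hn0⟩ := int_mul_log_add_int_mul_log_eq_zero hp hq hpq hZ
  have hsn : s.num = 0 := by
    rcases _root_.mul_eq_zero.1 (hm ▸ hm0) with h | h
    · exact h
    · exact absurd (by exact_mod_cast h) t.den_nz
  have htn : t.num = 0 := by
    rcases _root_.mul_eq_zero.1 (hn ▸ hn0) with h | h
    · exact h
    · exact absurd (by exact_mod_cast h) s.den_nz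
  exact ⟨Rat.zero_of_num_zero hsn, Rat.zero_of_num_zero htn⟩

/-- `1` and `x` are `ℚ`-linearly independent (in `ℂ`) for an irrational real `x` — the second
hypothesis of the four exponentials conjecture in Lagarias's footnote (`b₁ = 1`, `b₂ = x`).
Deliberate dot-notation extension of Mathlib's `Irrational` namespace.
[cite: Lagarias2002, §2 (footnote 2)] -/
theorem _root_.Irrational.linearIndependent_one {x : ℝ} (hx : Irrational x) :
    LinearIndependent ℚ ![(1 : ℂ), ((x : ℝ) : ℂ)] := by
  rw [LinearIndependent.pair_iff]
  intro s t hst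
  have hC : (((s : ℝ) + (t : ℝ) * x : ℝ) : ℂ) = 0 := by
    rw [Rat.smul_def, Rat.smul_def] at hst
    push_cast
    rw [← hst]
    ring
  have hR : (s : ℝ) + (t : ℝ) * x = 0 := by exact_mod_cast hC
  by_cases ht : t = 0
  · subst ht
    have : (s : ℝ) = 0 := by simpa using hR
    exact ⟨by exact_mod_cast this, rfl⟩
  · exfalso
    apply hx
    refine ⟨-s / t, ?_⟩
    have ht' : (t : ℝ) ≠ 0 := by exact_mod_cast ht
    push_cast
    field_simp
    linarith

/-- `e^{(log p) x} = p^x` as complex numbers (`p` prime, `x` real). [folklore] -/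
theorem cexp_log_mul_ofReal {p : ℕ} (hp : p.Prime) (x : ℝ) :
    Complex.exp (((Real.log p : ℝ) : ℂ) * ((x : ℝ) : ℂ)) = (((p : ℝ) ^ x : ℝ) : ℂ) := by
  have hp0 : (0 : ℝ) < p := by exact_mod_cast hp.pos
  rw [rpow_def_of_pos hp0, Complex.ofReal_exp]
  push_cast
  ring_nf

/-- The rational case of the Alaoglu–Erdős question (Lagarias 2002, §2, footnote 2: "For
non-integer rational `x` a direct argument is used"): if `p` is prime, `r ∈ ℚ` and `p^r ∈ ℚ`,
then `r ∈ ℤ` (`p^{num} = a^{den}`, so `den ∣ num` by `p`-adic valuation, and `gcd(num, den) = 1`).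
[cite: Lagarias2002, §2 (footnote 2)] -/
theorem exists_intCast_eq_of_prime_rpow_ratCast {p : ℕ} (hp : p.Prime) {r a : ℚ}
    (h : (p : ℝ) ^ (r : ℝ) = a) : ∃ k : ℤ, (r : ℝ) = k := by
  haveI := Fact.mk hp
  have hp0 : (0 : ℝ) < p := by exact_mod_cast hp.pos
  have hR : (p : ℝ) ^ r.num = (a : ℝ) ^ r.den := by
    have h1 : ((p : ℝ) ^ (r : ℝ)) ^ (r.den : ℕ) = (a : ℝ) ^ r.den := by rw [h]
    rw [← rpow_natCast, ← rpow_mul hp0.le] at h1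
    have h2 : (r : ℝ) * (r.den : ℕ) = (r.num : ℤ) := by exact_mod_cast Rat.mul_den_eq_num r
    rw [h2, rpow_intCast] at h1
    exact h1
  have hQ : (p : ℚ) ^ r.num = a ^ r.den := by
    have : (((p : ℚ) ^ r.num : ℚ) : ℝ) = ((a ^ r.den : ℚ) : ℝ) := by push_cast; exact hR
    exact_mod_cast this
  have hv := congrArg (padicValRat p) hQ
  rw [padicValRat.zpow, padicValRat.pow, padicValRat.self hp.one_lt, mul_one] at hv
  have hdvd : (r.den : ℤ) ∣ r.num := ⟨padicValRat p a, hv⟩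
  have hdvd' : r.den ∣ r.num.natAbs := Int.natCast_dvd.1 hdvd
  have hden : r.den = 1 := Nat.eq_one_of_dvd_coprimes r.reduced hdvd' dvd_rfl
  refine ⟨r.num, ?_⟩
  have : (r.num : ℚ) = r := Rat.coe_int_num_of_den_eq_one hden
  rw [← this]
  push_cast
  rfl

/-- **The four exponentials conjecture answers the Alaoglu–Erdős question positively**
(Lagarias 2002, §2: the conjecture of Alaoglu and Erdős is a consequence of the four
exponentials conjecture; footnote 2: for irrational `x` take `a₁ = log p`, `a₂ = log q`, `b₁ = 1`,
`b₂ = x` — the four exponentials `p, q, p^x, q^x` would all be rational, hence algebraic; for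
rational non-integer `x` a direct argument). The four exponentials conjecture is the tree's
`Literature.NumberTheory.Transcendental.FourExponentialsConjecture` (`Transcendental/PeriodsWave0.lean`).
[cite: Lagarias2002, §2 (footnote 2)] -/
theorem alaogluErdos_of_fourExponentials (h4 : Literature.NumberTheory.Transcendental.FourExponentialsConjecture) :
    ∀ (p q : ℕ) (x : ℝ), p.Prime → q.Prime → p ≠ q →
      (∃ a : ℚ, (p : ℝ) ^ x = a) → (∃ b : ℚ, (q : ℝ) ^ x = b) → ∃ k : ℤ, x = k := by
  intro p q x hp hq hpq ⟨a, ha⟩ ⟨b, hb⟩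
  by_cases hx : Irrational x
  · exfalso
    obtain ⟨i, j, hij⟩ := h4 _ _ (linearIndependent_log_of_prime_ne hp hq hpq)
      hx.linearIndependent_one
    apply hij
    fin_cases i <;> fin_cases j
    · simp only [Fin.zero_eta, Fin.isValue, Matrix.cons_val_zero, mul_one]
      rw [← Complex.ofReal_exp, Real.exp_log (by exact_mod_cast hp.pos)]
      exact_mod_cast isAlgebraic_nat p
    · simp only [Fin.zero_eta, Fin.isValue, Matrix.cons_val_zero, Fin.mk_one, Matrix.cons_val_one,
        Matrix.cons_val_fin_one]
      rw [cexp_log_mul_ofReal hp, ha]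
      exact_mod_cast isAlgebraic_rat ℚ a
    · simp only [Fin.mk_one, Fin.isValue, Matrix.cons_val_one, Matrix.cons_val_fin_one,
        Fin.zero_eta, Matrix.cons_val_zero, mul_one]
      rw [← Complex.ofReal_exp, Real.exp_log (by exact_mod_cast hq.pos)]
      exact_mod_cast isAlgebraic_nat q
    · simp only [Fin.mk_one, Fin.isValue, Matrix.cons_val_one, Matrix.cons_val_fin_one]
      rw [cexp_log_mul_ofReal hq, hb]
      exact_mod_cast isAlgebraic_rat ℚ b
  · obtain ⟨r, rfl⟩ : x ∈ Set.range ((↑) : ℚ → ℝ) := not_not.1 hx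
    exact exists_intCast_eq_of_prime_rpow_ratCast hp ha

/- Composing `alaogluErdos_of_fourExponentials` with `caSeq_dvd_succ_of_alaogluErdos` /
`caSeq_div_prime_of_alaogluErdos` re-proves the tree theorems
`Nat.caSeq_dvd_succ_of_fourExponentials` / `Nat.caSeq_div_prime_of_fourExponentials`
(`ColossallyAbundantQuotient.lean`), e.g.
`caSeq_dvd_succ_of_alaogluErdos (alaogluErdos_of_fourExponentials h4) : caSeq_dvd_succ`; they
are not restated here. -/

/-! ### The corrected reading of `Nat.caSeq_dvd_succ`: Alaoglu–Erdős's colossally abundant numbers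
divide all larger colossally abundant numbers (unconditional)

The named fact `Nat.caSeq_dvd_succ` (`ColossallyAbundant.lean`: `∀ k, caSeq k ∣ caSeq (k+1)` for
the all-maximisers convention) is not what Alaoglu–Erdős 1944 prove: by `Nat.caSeq_dvd_succ_iff`
(`ColossallyAbundantQuotient.lean`) it is equivalent to "no positive parameter is critical for two
distinct primes", i.e. to a positive answer to their Diophantine question in the cases that matter
(p. 449; p. 455: "It is very likely that `q^x` and `p^x` can not be rational at the same time
except if `x` is an integer. … At present we can not show this"; Lagarias 2002, §2: "still
unsolved"). What p. 455 does assert — "The numbers `n_ε` and `k_q(ε)` do not decrease as `ε`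
decreases", for THE colossally abundant number `n_ε = ∏ q^{k_q(ε)}` of Theorem 10, one per `ε` —
is, in the tree's vocabulary, the statement that a number colossally abundant in *their* sense
(`Nat.ColossallyAbundantAE`, p. 448) divides every maximiser of any `F_{ε'}` that is at least as
large. The three corollaries below phrase `Nat.IsCAParameter.dvd_of_le_of_forall_lt` this way;
they are the corrected statement that replaces `Nat.caSeq_dvd_succ` for users who need the
divisibility chain unconditionally. -/

/-- **Corrected form of `Nat.caSeq_dvd_succ`, mixed conventions** (Alaoglu–Erdős 1944, §3, p. 455:
"The numbers `n_ε` and `k_q(ε)` do not decrease as `ε` decreases"): a number `n` colossally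
abundant in Alaoglu–Erdős's sense (`Nat.ColossallyAbundantAE`: the largest maximiser of some
`F_ε`, p. 448) divides every colossally abundant number `n' ≥ n` of the tree's (all-maximisers)
convention. Unconditional; `Nat.IsCAParameter.dvd_of_le_of_forall_lt` with the definitions
unfolded. [cite: AlaogluErdos1944, §3, p. 455] -/
theorem ColossallyAbundantAE.dvd_of_le_of_colossallyAbundant {n n' : ℕ}
    (hn : ColossallyAbundantAE n) (hn' : ColossallyAbundant n') (hle : n ≤ n') : n ∣ n' := by
  obtain ⟨-, ε, -, hP, hPmax⟩ := hn
  obtain ⟨-, ε', -, hP'⟩ := hn'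
  exact IsCAParameter.dvd_of_le_of_forall_lt (ε := ε) (ε' := ε') hP hPmax hP' hle

/-- **Corrected form of `Nat.caSeq_dvd_succ` in Alaoglu–Erdős's convention** (1944, §3, p. 455):
the colossally abundant numbers in the sense of Alaoglu–Erdős (`Nat.ColossallyAbundantAE`) form a
chain under divisibility — `n ≤ n'` implies `n ∣ n'`. This is the theorem of the paper that the
named fact `Nat.caSeq_dvd_succ` transcribes onto the all-maximisers convention (where it is open,
`Nat.caSeq_dvd_succ_iff`). Unconditional. [cite: AlaogluErdos1944, §3, p. 455] -/
theorem ColossallyAbundantAE.dvd_of_le {n n' : ℕ} (hn : ColossallyAbundantAE n)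
    (hn' : ColossallyAbundantAE n') (hle : n ≤ n') : n ∣ n' :=
  hn.dvd_of_le_of_colossallyAbundant hn'.colossallyAbundant hle

/-- **Where the chain `Nat.caSeq_dvd_succ` can break** (unconditional): if the term `caSeq k` is
colossally abundant in Alaoglu–Erdős's sense, then `caSeq k ∣ caSeq (k + 1)`. Hence a failure of
`Nat.caSeq_dvd_succ` at `k` requires `caSeq k` to be a maximiser that is not the largest one of
any parameter — by Erdős–Nicolas 1975, Prop. 4 (d) a middle maximiser `qN < rN` at a parameter
shared by two primes `q ≠ r`, the configuration Alaoglu–Erdős (p. 455) could not exclude.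
[cite: AlaogluErdos1944, §3, p. 455] -/
theorem caSeq_dvd_succ_of_colossallyAbundantAE {k : ℕ} (hk : ColossallyAbundantAE (caSeq k)) :
    caSeq k ∣ caSeq (k + 1) :=
  hk.dvd_of_le_of_colossallyAbundant (colossallyAbundant_caSeq' (k + 1))
    (caSeq_strictMono'.monotone (Nat.le_succ k))

end Nat

end
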